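import Summits.Ventures.HodgeRepro2.T6A2WeilFull
import Summits.Ventures.HodgeRepro2.T6A2WeilSituation
import Summits.Ventures.HodgeRepro2.T6A2Shadow

/-!
# T6A2WeilIdent — the model identification `IdentB` of the A2 glue on the host Weil cohomology

Cell pub-hodge-repro2, Tier 6 (README §10), seat t6-p2 (A2 host side; lead ruling STATUS l. 5353 (4): the
Layer-III cut on the host's own axiomatics, `IdentB` from ONE Lange display and the A1-side `φ₁`).

For `W : WeilCohomology k ℚ` and the A2 situation `D : SituationData k` on the host (T6A2WeilSituation),
this file builds the first identification structure of the A2 glue, `A2Shadow.IdentB (D.situation …) K`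
(T6A2Shadow l. 113: `ev : H^{even}(B) →ₐ[ℚ] HB K`, an order `O′ ⊂ K` acting by endomorphisms, `ev_pull_endo`,
`exists_natCast_mul_mem`), from
* `evenToFull W P : EvenRing W P →ₐ[ℚ] FullRing W P` — the even-degree ring inside the full cohomology
  ring (degree `i` ↦ degree `2 i`), with `evenToFull_pull` (it commutes with pull-backs);
* `pullF W f : FullRing W Q →ₐ[ℚ] FullRing W P` — the pull-back on the full ring, with `pullF_langeMap`
  (`f^* ∘ langeMap = langeMap ∘ ⋀(f^* on H¹)`: the naturality of the exterior-algebra map);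
* the A1-SIDE DATUM `OrderAction W B K` = {an order `O′ : Subring K`, honest endomorphisms
  `endo x : B → B` for `x ∈ O′` (Shimura's `ι` on an order, TIER4 A0.2), `exists_natCast_mul_mem`, and the
  rational `K`-equivariant identification `φ₁ : H¹(B, ℚ) ≃ H1 K` of A1 (`φ₁_act`)} — owned by t6-p1
  (STATUS l. 5353 (4)), consumed here;
* ONE display BINDER `hL : Function.Bijective (langeMap W D.B)` (Lange–Birkenhake Prop. 1.1.20 with
  Exercise 1.1.6(7), the A1 row H6 of TARGET-T6 §3 — displayed by its owner, not here).

`identB W D hgen hten A hL : IdentB (D.situation W hgen hten) K` has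
`ev = ⋀(φ₁⁻¹) ∘ langeMap⁻¹ ∘ evenToFull` and `ev_pull_endo` is PROVED (`ExteriorAlgebra.hom_ext` on the
generators: `langeMap` is natural, `φ₁` is equivariant, `pullEndo K x = ⋀(actH1 K x)`).
No `sorry`; standard axioms. §8(d): uses an L-value-free non-vanishing device: NO.
-/

noncomputable section

namespace Summit.Ventures.HodgeRepro2.T6.WeilInst

open HostAPI.Carriers.AlgebraicGeometry.Motives CategoryTheory Opposite
open Summit.Ventures.HodgeRepro2.T6 Summit.Ventures.HodgeRepro2.T6.A2Gysin
  Summit.Ventures.HodgeRepro2.T6.A2Shadow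
open scoped DirectSum

universe u

variable {k : Type u} [Field k] (W : WeilCohomology k ℚ)

section evenToFull

variable (P : SPVar k)

/-- `ofDegF` along an equality of degrees -/
theorem ofDegF_castDeg {i i' : ℕ} (h : i = i') (a : W.obj P.X i) :
    ofDegF W P i' (castDeg W h a) = ofDegF W P i a := by
  subst h; rfl

/-- the even-degree ring inside the full ring, as a linear map: degree `i` ↦ degree `2 i` -/
def evenToFullLin : EvenRing W P →ₗ[ℚ] FullRing W P :=
  DirectSum.toModule ℚ ℕ (FullRing W P) fun i => ofDegF W P (2 * i)

/-- `evenToFullLin` on a homogeneous element -/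
theorem evenToFullLin_ofDeg (i : ℕ) (a : Ev W P.X i) :
    evenToFullLin W P (ofDeg W P i a) = ofDegF W P (2 * i) a := by
  simp [evenToFullLin, ofDeg, DirectSum.toModule_lof]

/-- THE EVEN-DEGREE RING INSIDE THE FULL RING, as a `ℚ`-algebra homomorphism. -/
def evenToFull : EvenRing W P →ₐ[ℚ] FullRing W P :=
  AlgHom.ofLinearMap (evenToFullLin W P)
    (by rw [one_def, evenToFullLin_ofDeg]; rfl)
    (by
      intro x y
      induction x using DirectSum.induction_on with
      | zero => simp
      | of i a =>
        induction y using DirectSum.induction_on with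
        | zero => simp
        | of j b =>
          rw [← DirectSum.lof_eq_of ℚ, ← DirectSum.lof_eq_of ℚ]
          change evenToFullLin W P (ofDeg W P i a * ofDeg W P j b) =
            evenToFullLin W P (ofDeg W P i a) * evenToFullLin W P (ofDeg W P j b)
          rw [ofDeg_mul_ofDeg, evenToFullLin_ofDeg, evenToFullLin_ofDeg, evenToFullLin_ofDeg,
            ofDegF_mul_ofDegF, ← ofDegF_castDeg W P (by omega : 2 * i + 2 * j = 2 * (i + j)), castDeg_cup]
        | add y z hy hz => rw [mul_add, map_add, hy, hz, map_add, mul_add]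
      | add x z hx hz => rw [add_mul, map_add, hx, hz, map_add, add_mul])

/-- `evenToFull` on a homogeneous element -/
theorem evenToFull_ofDeg (i : ℕ) (a : Ev W P.X i) :
    evenToFull W P (ofDeg W P i a) = ofDegF W P (2 * i) a :=
  evenToFullLin_ofDeg W P i a

end evenToFull

section pullF

variable {P Q : SPVar k} (f : P.X ⟶ Q.X)

/-- the pull-back `f^*` on the full cohomology rings, as a `ℚ`-algebra homomorphism -/
def pullF : FullRing W Q →ₐ[ℚ] FullRing W P :=
  AlgHom.ofLinearMap (DirectSum.lmap fun i => W.pullback f i)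
    (by
      change DirectSum.lmap _ (ofDegF W Q 0 (W.one Q.X)) = ofDegF W P 0 (W.one P.X)
      rw [ofDegF, DirectSum.lmap_lof, W.map_one P.smooth Q.smooth f])
    (by
      intro x y
      induction x using DirectSum.induction_on with
      | zero => simp
      | of i a =>
        induction y using DirectSum.induction_on with
        | zero => simp
        | of j b =>
          rw [← DirectSum.lof_eq_of ℚ, ← DirectSum.lof_eq_of ℚ]
          change _ = DirectSum.lmap _ (ofDegF W Q i a) * DirectSum.lmap _ (ofDegF W Q j b)
          rw [ofDegF_mul_ofDegF, ofDegF, DirectSum.lmap_lof, DirectSum.lmap_lof, DirectSum.lmap_lof,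
            ← ofDegF, ← ofDegF, ← ofDegF, ofDegF_mul_ofDegF, W.map_cup P.smooth Q.smooth f]
        | add y z hy hz => rw [mul_add, map_add, hy, hz, map_add, mul_add]
      | add x z hx hz => rw [add_mul, map_add, hx, hz, map_add, add_mul])

/-- `pullF` on a homogeneous element -/
theorem pullF_ofDegF (i : ℕ) (a : W.obj Q.X i) :
    pullF W f (ofDegF W Q i a) = ofDegF W P i (W.pullback f i a) := by
  simp [pullF, ofDegF, DirectSum.lmap_lof]

/-- the even ring's pull-back is the full ring's pull-back -/
theorem evenToFull_pull (x : EvenRing W Q) :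
    evenToFull W P (pull W f x) = pullF W f (evenToFull W Q x) := by
  induction x using DirectSum.induction_on with
  | zero => simp
  | of i a =>
    rw [← DirectSum.lof_eq_of ℚ]
    change evenToFull W P (pull W f (ofDeg W Q i a)) = pullF W f (evenToFull W Q (ofDeg W Q i a))
    rw [pull_ofDeg, evenToFull_ofDeg, evenToFull_ofDeg, pullF_ofDegF]
  | add x y hx hy => rw [map_add, map_add, hx, hy, map_add, map_add]

/-- THE NATURALITY OF THE EXTERIOR-ALGEBRA MAP: `f^* ∘ langeMap = langeMap ∘ ⋀(f^* on H¹)`. -/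
theorem pullF_langeMap (t : ExteriorAlgebra ℚ (W.obj Q.X 1)) :
    pullF W f (langeMap W Q t) = langeMap W P (ExteriorAlgebra.map (W.pullback f 1) t) := by
  have h : (pullF W f).comp (langeMap W Q) =
      (langeMap W P).comp (ExteriorAlgebra.map (W.pullback f 1)) := by
    apply ExteriorAlgebra.hom_ext
    refine LinearMap.ext fun a => ?_
    simp only [LinearMap.comp_apply, AlgHom.toLinearMap_apply, AlgHom.comp_apply, langeMap_ι,
      ExteriorAlgebra.map_apply_ι]
    exact pullF_ofDegF W f 1 a
  exact congrArg (fun g => g t) h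

end pullF

section orderAction

variable (B : SPVar k) (K : Type*) [Field K] [NumberField K]

/-- THE A1-SIDE DATUM OF THE IDENTIFICATION (owner t6-p1, STATUS l. 5353 (4); consumed here): an order
`O′ ⊂ K` acting on `B` by honest endomorphisms `endo x : B → B` (Shimura's `ι` restricted to an order,
TIER4 A0.2 `O′ = ℤ + n O_K`), every `x ∈ K` having a positive integer multiple in `O′`, and the rational
`K`-equivariant identification `φ₁ : H1 K ≃ H¹(B, ℚ)` of A1 (`φ₁_act`: the diagonal action `actH1 K x` on
`H1 K` is `[x]^*` on `H¹(B, ℚ)` for `x ∈ O′`). No field asserts a printed theorem. -/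
structure OrderAction where
  /-- the order `O′ ⊂ K` acting on `B` -/
  O' : Subring K
  /-- the endomorphism `[x] : B → B`, `x ∈ O′` -/
  endo : ∀ x ∈ O', (B.X ⟶ B.X)
  /-- every element of `K` has a positive integer multiple in `O′` -/
  exists_natCast_mul_mem : ∀ x : K, ∃ n : ℕ, 0 < n ∧ (n : K) * x ∈ O'
  /-- the rational identification `H1 K = H¹(B, ℚ)` -/
  φ₁ : H1 K ≃ₗ[ℚ] W.obj B.X 1
  /-- `φ₁` intertwines the diagonal `K`-action with `[x]^*`, `x ∈ O′` -/
  φ₁_act : ∀ x (hx : x ∈ O') (v : H1 K), φ₁ (actH1 K x v) = W.pullback (endo x hx) 1 (φ₁ v)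

namespace OrderAction

variable {W B K} (A : OrderAction W B K)

/-- the inverse identification intertwines `[x]^*` with the diagonal action -/
theorem symm_pullback (x : K) (hx : x ∈ A.O') (w : W.obj B.X 1) :
    A.φ₁.symm (W.pullback (A.endo x hx) 1 w) = actH1 K x (A.φ₁.symm w) := by
  apply A.φ₁.injective
  rw [LinearEquiv.apply_symm_apply, A.φ₁_act x hx, LinearEquiv.apply_symm_apply]

/-- as linear maps: `φ₁⁻¹ ∘ [x]^* = actH1 x ∘ φ₁⁻¹` -/
theorem symm_comp_pullback (x : K) (hx : x ∈ A.O') :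
    (A.φ₁.symm : W.obj B.X 1 →ₗ[ℚ] H1 K) ∘ₗ W.pullback (A.endo x hx) 1 =
      actH1 K x ∘ₗ (A.φ₁.symm : W.obj B.X 1 →ₗ[ℚ] H1 K) :=
  LinearMap.ext fun w => A.symm_pullback x hx w

end OrderAction

end orderAction

section identB

variable {K : Type*} [Field K] [NumberField K]

/-- `pullEndo K x` is the exterior-algebra map of `actH1 K x` -/
theorem pullEndo_eq_map (x : K) : pullEndo K x = ExteriorAlgebra.map (actH1 K x) := by
  apply ExteriorAlgebra.hom_ext
  refine LinearMap.ext fun w => ?_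
  simp only [LinearMap.comp_apply, AlgHom.toLinearMap_apply]
  rw [pullEndo, ExteriorAlgebra.lift_ι_apply, ExteriorAlgebra.map_apply_ι]
  rfl

variable (D : SituationData k) (hgen : D.HasGens) (hten : D.ProductsSmooth)

/-- the Lange isomorphism `⋀ H¹(B, ℚ) ≃ H^*(B, ℚ)` from the display binder -/
def langeEquiv (hL : Function.Bijective (langeMap W D.B)) :
    ExteriorAlgebra ℚ (W.obj D.B.X 1) ≃ₐ[ℚ] FullRing W D.B :=
  AlgEquiv.ofBijective (langeMap W D.B) hL

/-- `langeEquiv` is `langeMap` -/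
theorem langeEquiv_apply (hL : Function.Bijective (langeMap W D.B)) (t : ExteriorAlgebra ℚ (W.obj D.B.X 1)) :
    langeEquiv W D hL t = langeMap W D.B t := rfl

/-- the inverse of the Lange isomorphism is natural for the pull-back along an endomorphism -/
theorem langeEquiv_symm_pullF (hL : Function.Bijective (langeMap W D.B)) (g : D.B.X ⟶ D.B.X)
    (y : FullRing W D.B) :
    (langeEquiv W D hL).symm (pullF W g y) =
      ExteriorAlgebra.map (W.pullback g 1) ((langeEquiv W D hL).symm y) := by
  apply (langeEquiv W D hL).injective
  rw [AlgEquiv.apply_symm_apply, langeEquiv_apply, ← pullF_langeMap, ← langeEquiv_apply W D hL,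
    AlgEquiv.apply_symm_apply]

/-- THE IDENTIFICATION MAP `ev : H^{even}(B, ℚ) → HB K = ⋀ H1 K`: `⋀(φ₁⁻¹) ∘ langeMap⁻¹ ∘ evenToFull`. -/
def evOf (A : OrderAction W D.B K) (hL : Function.Bijective (langeMap W D.B)) :
    EvenRing W D.B →ₐ[ℚ] HB K :=
  (ExteriorAlgebra.map (A.φ₁.symm : W.obj D.B.X 1 →ₗ[ℚ] H1 K)).comp
    ((langeEquiv W D hL).symm.toAlgHom.comp (evenToFull W D.B))

/-- `ev`, unfolded -/
theorem evOf_apply (A : OrderAction W D.B K) (hL : Function.Bijective (langeMap W D.B)) (a : EvenRing W D.B) :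
    evOf W D A hL a =
      ExteriorAlgebra.map (A.φ₁.symm : W.obj D.B.X 1 →ₗ[ℚ] H1 K)
        ((langeEquiv W D hL).symm (evenToFull W D.B a)) := rfl

/-- `ev ∘ [x]^* = pullEndo x ∘ ev` on `H^{even}(B, ℚ)` for `x ∈ O′` -/
theorem evOf_pull (A : OrderAction W D.B K) (hL : Function.Bijective (langeMap W D.B)) (x : K)
    (hx : x ∈ A.O') (a : EvenRing W D.B) :
    evOf W D A hL (pull W (A.endo x hx) a) = pullEndo K x (evOf W D A hL a) := by
  rw [evOf_apply, evOf_apply, evenToFull_pull, langeEquiv_symm_pullF, pullEndo_eq_map,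
    ← AlgHom.comp_apply (ExteriorAlgebra.map (actH1 K x)), ExteriorAlgebra.map_comp_map,
    ← A.symm_comp_pullback x hx, ← ExteriorAlgebra.map_comp_map, AlgHom.comp_apply]

/-- THE MODEL IDENTIFICATION `IdentB` OF THE A2 GLUE ON THE HOST, from the A1-side datum and the Lange
display binder. -/
def identB (A : OrderAction W D.B K) (hL : Function.Bijective (langeMap W D.B)) :
    IdentB (D.situation W hgen hten) K where
  ev := evOf W D A hL
  O' := A.O'
  endo x hx := A.endo x hx
  ev_pull_endo x hx a := evOf_pull W D A hL x hx a
  exists_natCast_mul_mem := A.exists_natCast_mul_mem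

/-- `(identB …).ev` is `evOf` -/
theorem identB_ev (A : OrderAction W D.B K) (hL : Function.Bijective (langeMap W D.B)) :
    (identB W D hgen hten A hL).ev = evOf W D A hL := rfl

end identB

end Summit.Ventures.HodgeRepro2.T6.WeilInst

end
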